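import Summits.QuantumFields.YangMills.Theses.PencilRigidity
import Summits.QuantumFields.YangMills.Theorems.HypercubicLimit.Negative.ExtendByZero
import Summits.QuantumFields.YangMills.Theorems.PencilRigidityCurvatureChannel
import Summits.QuantumFields.YangMills.Theses.MirrorModularBoosts

/-!
# `WeakCouplingHypercubicLimitRP` (FOLD, shape F) is ON PATH: `YangMills` ⟹ the new existence leg

Support file for the FOLD (shape F) items `PencilRigidity.WeakCouplingHypercubicLimitRP` and `MirrorModularBoosts.WeakCouplingHypercubicLimitRP`
(= IsotropyFromPowerCounting's, same body): the negative side is the summit's.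
  From a summit witness `(r, sch, T)`: silence every species other than the curvature (keeps `β`, hence the
weak-coupling clause, and `(a, L)`, hence `HasLatticeMassGap`), replace `T.schwinger` by the extension by zero of its
curvature channel (pattern of `Theorems/WeakCouplingHypercubicLimit/Negative/SummitTie.lean`, stmt-16120), and — the one new
point — read the DIAGONAL-FRAME reflection positivity of the curvature channel off the summit's FULL `SO(4)` covariance: for a
frame `R` with `R e₀ = v := a e₀ + b e₁`, `a² = b² = ½`, the rotation `g := σ_{v−e₀} ∘ σ_{e₂}` (two hyperplane reflections,
determinant `1`) maps `v` to `e₀`; invariance of the channel under `g` on `⁰𝒮` and transport along the time axis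
(`CurvatureChannel.isReflectionPositive_comp_of_trans` / `_of_map_e0`) give E2 in pull-back form by `R`.  Consequence: any kill
of the new crux refutes `YangMills` as typed; the crux is NECESSARY for the summit. HONEST LABEL: nothing here proves the crux or
the summit; the Yang–Mills mass gap is NOT proved. [folklore; OsterwalderSchrader1973 §3; GlimmJaffe1987 §6.1]
-/

noncomputable section

open scoped SchwartzMap
open MeasureTheory Filter Topology Complex
open Literature.MathematicalPhysics.AQFT Literature.MathematicalPhysics.QuantumLattice
open Literature.MathematicalPhysics.QuantumFieldTheory
open Summit.QuantumFields.YangMills.Theorems.HypercubicLimit.Negative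

namespace Summit.QuantumFields.YangMills.Theorems.WeakCouplingHypercubicLimitRP.Negative

section DiagFrame

open Summit.QuantumFields.YangMills.Theorems.CurvatureChannel in
/-- **Diagonal frames from full rotation covariance.** A one-species family on `ℝ⁴` that is reflection positive and
invariant on `⁰𝒮` under every rotation is reflection positive in pull-back form for every frame `R` with
`R e₀ = a e₀ + b e₁`, `a² = b² = ½`: the rotation `σ_{v−e₀} ∘ σ_{e₂}` (`v := R e₀`, a unit vector with `v − e₀ ≠ 0`) maps `v`
to `e₀`. [folklore] -/
theorem isReflectionPositive_comp_diagFrame (S₁ : SchwingerFamily (EuclideanSpace ℝ (Fin 4)))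
    (hRP : S₁.toLabelled.IsReflectionPositive)
    (hRot : ∀ g : EuclideanSpace ℝ (Fin 4) ≃ₗᵢ[ℝ] EuclideanSpace ℝ (Fin 4),
      LinearMap.det (g.toLinearEquiv : EuclideanSpace ℝ (Fin 4) →ₗ[ℝ] EuclideanSpace ℝ (Fin 4)) = 1 →
      ∀ (n : ℕ) (F : 𝓢((Fin n → EuclideanSpace ℝ (Fin 4)), ℂ)), IsOffDiagonal F → S₁ n (linActMulti g F) = S₁ n F)
    (R : EuclideanSpace ℝ (Fin 4) ≃ₗᵢ[ℝ] EuclideanSpace ℝ (Fin 4)) (a b : ℝ) (ha : a ^ 2 = 1 / 2) (hb : b ^ 2 = 1 / 2)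
    (hR : R (EuclideanSpace.single 0 1) = a • EuclideanSpace.single 0 1 + b • EuclideanSpace.single 1 1) :
    (SchwingerFamily.toLabelled (fun n => (S₁ n).comp (linActMulti R))).IsReflectionPositive := by
  have hb0 : b ≠ 0 := by
    rintro rfl
    norm_num at hb
  -- `v := R e₀ = a e₀ + b e₁` is a unit vector different from `e₀`; `g := σ_{v - e₀} ∘ σ_{e₂}` is a rotation with `g v = e₀`
  set v : EuclideanSpace ℝ (Fin 4) := a • EuclideanSpace.single 0 1 + b • EuclideanSpace.single 1 1 with hv
  have hvz : v - EuclideanSpace.single 0 1 ≠ 0 := by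
    intro h
    have h1 := congrArg (fun w : EuclideanSpace ℝ (Fin 4) => w 1) h
    simp [hv] at h1
    exact hb0 h1
  have hsq : ‖v‖ ^ 2 = 1 := by
    rw [hv, EuclideanSpace.norm_sq_eq, Fin.sum_univ_four]
    simp [ha, hb]
    norm_num
  have hv1 : ‖v‖ = ‖(EuclideanSpace.single 0 1 : EuclideanSpace ℝ (Fin 4))‖ := by
    rw [(pow_eq_one_iff_of_nonneg (norm_nonneg _) two_ne_zero).mp hsq]
    simp
  set g : EuclideanSpace ℝ (Fin 4) ≃ₗᵢ[ℝ] EuclideanSpace ℝ (Fin 4) :=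
    (Submodule.reflection (Submodule.span ℝ ({v - EuclideanSpace.single 0 1} : Set (EuclideanSpace ℝ (Fin 4))))ᗮ).trans
      (Submodule.reflection (Submodule.span ℝ
        ({(EuclideanSpace.single 2 1 : EuclideanSpace ℝ (Fin 4))} : Set (EuclideanSpace ℝ (Fin 4))))ᗮ) with hg_def
  have hdet : LinearMap.det (g.toLinearEquiv : EuclideanSpace ℝ (Fin 4) →ₗ[ℝ] EuclideanSpace ℝ (Fin 4)) = 1 :=
    det_reflection_trans_reflection hvz (single_ne_zero 2)
  have hg : g v = EuclideanSpace.single 0 1 := by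
    show (Submodule.reflection (Submodule.span ℝ
        ({(EuclideanSpace.single 2 1 : EuclideanSpace ℝ (Fin 4))} : Set (EuclideanSpace ℝ (Fin 4))))ᗮ)
      ((Submodule.reflection (Submodule.span ℝ ({v - EuclideanSpace.single 0 1} : Set (EuclideanSpace ℝ (Fin 4))))ᗮ) v) =
        EuclideanSpace.single 0 1
    rw [Submodule.reflection_sub hv1]
    exact reflection_single_of_ne (by decide)
  refine isReflectionPositive_comp_of_trans S₁ (hRot _ hdet) R ?_
  exact isReflectionPositive_comp_of_map_e0 S₁ hRP (Q := R.trans g) (by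
    show g (R _) = _
    rw [hR]
    exact hg)

end DiagFrame

/-- **`YangMills` ⟹ `PencilRigidity.WeakCouplingHypercubicLimitRP`** (the FOLD crux is on path). [folklore] -/
theorem weakCouplingHypercubicLimitRP_of_yangMills (hYM : YangMills) :
    Summit.QuantumFields.YangMills.Theses.PencilRigidity.WeakCouplingHypercubicLimitRP :=
    fun G _ _ _ _ hG => by
  letI : MeasurableSpace G := borel G
  haveI : BorelSpace G := ⟨rfl⟩
  obtain ⟨r, sch, T, hweak, hconv, hnt, hng, Δ, hΔ, hgap, hlat⟩ := hYM G hG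
  classical
  -- the scheme silencing every species but the curvature (same `a, β, L, m`)
  let sch' : SpeciesScheme (YMSpecies G) :=
    { sch with c := fun s k => if s = r.curvature then sch.c s k else 0 }
  have hne : ∀ (k n : ℕ) (σ : Fin n → YMSpecies G) (f : Fin n → SchwartzMap (EuclideanSpace ℝ (Fin 4)) ℝ) (i₀ : Fin n),
      σ i₀ ≠ r.curvature → latticeSchwinger r.ρ sch' (fun s => s.F) k n σ f = 0 := by
    intro k n σ f i₀ hi₀
    unfold latticeSchwinger
    have h0 : sch'.c (σ i₀) k = 0 := by simp [sch', hi₀]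
    have : ∀ U : GaugeConfig 4 (sch'.side k) G,
        ∏ i, smearedLatticeField ((fun s : YMSpecies G => s.F) (σ i))
          (Literature.Probability.LatticeModels.box 4 (sch'.L k)) (sch'.a k) (sch'.c (σ i) k)
          (sch'.m (σ i) k) (f i) (torusLift (sch'.side k) U) = 0 := fun U =>
      Finset.prod_eq_zero (Finset.mem_univ i₀) (by rw [h0]; simp [smearedLatticeField])
    simp_rw [this, integral_zero]
  have hself : ∀ (k n : ℕ) (f : Fin n → SchwartzMap (EuclideanSpace ℝ (Fin 4)) ℝ),
      latticeSchwinger r.ρ sch' (fun s => s.F) k n (fun _ => r.curvature) f =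
        latticeSchwinger r.ρ sch (fun s => s.F) k n (fun _ => r.curvature) f := by
    intro k n f
    have hc : sch'.c r.curvature k = sch.c r.curvature k := by simp [sch']
    unfold latticeSchwinger
    simp_rw [hc]
    rfl
  have hos : (T.schwinger.IsNormalized ∧ T.schwinger.IsHermitian ∧ T.schwinger.HasLinearGrowth ∧ T.schwinger.IsReflectionPositive ∧ T.schwinger.IsSymmetric ∧ T.schwinger.HasClusterProperty ∧ (∀ (n : ℕ) (k : Fin n → YMSpecies G) (a : (EuclideanSpace ℝ (Fin 4))) (F : 𝓢((Fin n → (EuclideanSpace ℝ (Fin 4))), ℂ)), IsOffDiagonal F → T.schwinger n k (translateMulti a F) = T.schwinger n k F) ∧ (∀ (n : ℕ) (k : Fin n → YMSpecies G) (R : (EuclideanSpace ℝ (Fin 4)) ≃ₗᵢ[ℝ] (EuclideanSpace ℝ (Fin 4))), LinearMap.det (R.toLinearEquiv : (EuclideanSpace ℝ (Fin 4)) →ₗ[ℝ] (EuclideanSpace ℝ (Fin 4))) = 1 → (∀ i : Fin 4, ∃ j : Fin 4, R (EuclideanSpace.single i 1) = EuclideanSpace.single j 1 ∨ R (EuclideanSpace.single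 i 1) = -EuclideanSpace.single j 1) → ∀ F : 𝓢((Fin n → (EuclideanSpace ℝ (Fin 4))), ℂ), IsOffDiagonal F → T.schwinger n k (linActMulti R F) = T.schwinger n k F)) :=
    ⟨T.normalized, T.hermitian, T.linearGrowth, T.reflectionPositive, T.symmetric, T.cluster,
      T.invariant.1, fun n k R hdet _ F hF => T.invariant.2 n k R hdet F hF⟩
  refine ⟨r, sch', extendByZero r.curvature (restrictTo r.curvature T.schwinger), hweak, ?_, ?_,
    osClauses_extendByZero (osClauses_restrictTo _ hos), ?_, ?_, ?_, Δ, hΔ,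
    hasMassGap_extendByZero (hasMassGap_restrictTo _ hgap), hlat⟩
  · -- NEW (FOLD): reflection positivity of the curvature channel in the four diagonal frames, from full SO(4) covariance
    intro R a b ha hb hR
    simp only [extendByZero_const]
    exact isReflectionPositive_comp_diagFrame (restrictTo r.curvature T.schwinger)
      (osClauses_restrictTo _ hos).2.2.2.1
      (fun g hdet n F hF => T.invariant.2 n (fun _ => r.curvature) g hdet F hF) R a b ha hb hR
  · -- one-field gauge
    rintro n k ⟨i, hi⟩ F
    rw [extendByZero_of_not_all _ _ (fun hall => hi (hall i))]
    rfl
  · -- convergence along the silenced scheme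
    intro n hn σ f F hF hod
    by_cases hσ : ∀ i, σ i = r.curvature
    · obtain rfl : σ = fun _ => r.curvature := funext hσ
      rw [extendByZero_const]
      simp_rw [hself]
      exact hconv n hn _ f F hF hod
    · push Not at hσ
      obtain ⟨i₀, hi₀⟩ := hσ
      rw [extendByZero_of_not_all _ _ (fun hall => hi₀ (hall i₀))]
      simp_rw [hne _ n σ f i₀ hi₀]
      simp
  · -- non-triviality of the curvature channel
    unfold OSData.IsNontrivial at hnt
    simpa [restrictTo] using hnt
  · -- non-Gaussianity of the curvature channel
    unfold OSData.IsNonGaussian at hng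
    simpa [restrictTo] using hng

/-- **`YangMills` ⟹ `MirrorModularBoosts.WeakCouplingHypercubicLimitRP`.** [folklore] -/
theorem weakCouplingHypercubicLimitRP_mmb_of_yangMills (hYM : YangMills) :
    Summit.QuantumFields.YangMills.Theses.MirrorModularBoosts.WeakCouplingHypercubicLimitRP :=
    fun G _ _ _ _ hG => by
  letI : MeasurableSpace G := borel G
  haveI : BorelSpace G := ⟨rfl⟩
  obtain ⟨r, sch, T, hweak, hconv, hnt, hng, Δ, hΔ, hgap, hlat⟩ := hYM G hG
  classical
  -- the scheme silencing every species but the curvature (same `a, β, L, m`)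
  let sch' : SpeciesScheme (YMSpecies G) :=
    { sch with c := fun s k => if s = r.curvature then sch.c s k else 0 }
  have hne : ∀ (k n : ℕ) (σ : Fin n → YMSpecies G) (f : Fin n → SchwartzMap (EuclideanSpace ℝ (Fin 4)) ℝ) (i₀ : Fin n),
      σ i₀ ≠ r.curvature → latticeSchwinger r.ρ sch' (fun s => s.F) k n σ f = 0 := by
    intro k n σ f i₀ hi₀
    unfold latticeSchwinger
    have h0 : sch'.c (σ i₀) k = 0 := by simp [sch', hi₀]
    have : ∀ U : GaugeConfig 4 (sch'.side k) G,
        ∏ i, smearedLatticeField ((fun s : YMSpecies G => s.F) (σ i))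
          (Literature.Probability.LatticeModels.box 4 (sch'.L k)) (sch'.a k) (sch'.c (σ i) k)
          (sch'.m (σ i) k) (f i) (torusLift (sch'.side k) U) = 0 := fun U =>
      Finset.prod_eq_zero (Finset.mem_univ i₀) (by rw [h0]; simp [smearedLatticeField])
    simp_rw [this, integral_zero]
  have hself : ∀ (k n : ℕ) (f : Fin n → SchwartzMap (EuclideanSpace ℝ (Fin 4)) ℝ),
      latticeSchwinger r.ρ sch' (fun s => s.F) k n (fun _ => r.curvature) f =
        latticeSchwinger r.ρ sch (fun s => s.F) k n (fun _ => r.curvature) f := by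
    intro k n f
    have hc : sch'.c r.curvature k = sch.c r.curvature k := by simp [sch']
    unfold latticeSchwinger
    simp_rw [hc]
    rfl
  have hos : (T.schwinger.IsNormalized ∧ T.schwinger.IsHermitian ∧ T.schwinger.HasLinearGrowth ∧ T.schwinger.IsReflectionPositive ∧ T.schwinger.IsSymmetric ∧ T.schwinger.HasClusterProperty ∧ (∀ (n : ℕ) (k : Fin n → YMSpecies G) (a : (EuclideanSpace ℝ (Fin 4))) (F : 𝓢((Fin n → (EuclideanSpace ℝ (Fin 4))), ℂ)), IsOffDiagonal F → T.schwinger n k (translateMulti a F) = T.schwinger n k F) ∧ (∀ (n : ℕ) (k : Fin n → YMSpecies G) (R : (EuclideanSpace ℝ (Fin 4)) ≃ₗᵢ[ℝ] (EuclideanSpace ℝ (Fin 4))), LinearMap.det (R.toLinearEquiv : (EuclideanSpace ℝ (Fin 4)) →ₗ[ℝ] (EuclideanSpace ℝ (Fin 4))) = 1 → (∀ i : Fin 4, ∃ j : Fin 4, R (EuclideanSpace.single i 1) = EuclideanSpace.single j 1 ∨ R (EuclideanSpace.single i 1) = -EuclideanSpace.single j 1) → ∀ F : 𝓢((Fin n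 → (EuclideanSpace ℝ (Fin 4))), ℂ), IsOffDiagonal F → T.schwinger n k (linActMulti R F) = T.schwinger n k F)) :=
    ⟨T.normalized, T.hermitian, T.linearGrowth, T.reflectionPositive, T.symmetric, T.cluster,
      T.invariant.1, fun n k R hdet _ F hF => T.invariant.2 n k R hdet F hF⟩
  refine ⟨r, sch', extendByZero r.curvature (restrictTo r.curvature T.schwinger), hweak, ?_,
    osClauses_extendByZero (osClauses_restrictTo _ hos), ?_, ?_, ?_, Δ, hΔ,
    hasMassGap_extendByZero (hasMassGap_restrictTo _ hgap), hlat⟩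
  · -- NEW (FOLD): reflection positivity of the curvature channel in the four diagonal frames, from full SO(4) covariance
    intro R a b ha hb hR
    simp only [extendByZero_const]
    exact isReflectionPositive_comp_diagFrame (restrictTo r.curvature T.schwinger)
      (osClauses_restrictTo _ hos).2.2.2.1
      (fun g hdet n F hF => T.invariant.2 n (fun _ => r.curvature) g hdet F hF) R a b ha hb hR
  · -- convergence along the silenced scheme
    intro n hn σ f F hF hod
    by_cases hσ : ∀ i, σ i = r.curvature
    · obtain rfl : σ = fun _ => r.curvature := funext hσ
      rw [extendByZero_const]
      simp_rw [hself]
      exact hconv n hn _ f F hF hod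
    · push Not at hσ
      obtain ⟨i₀, hi₀⟩ := hσ
      rw [extendByZero_of_not_all _ _ (fun hall => hi₀ (hall i₀))]
      simp_rw [hne _ n σ f i₀ hi₀]
      simp
  · -- non-triviality of the curvature channel
    unfold OSData.IsNontrivial at hnt
    simpa [restrictTo] using hnt
  · -- non-Gaussianity of the curvature channel
    unfold OSData.IsNonGaussian at hng
    simpa [restrictTo] using hng

/-- **Any kill of `PencilRigidity.WeakCouplingHypercubicLimitRP` refutes `YangMills` as typed.** [folklore] -/
theorem not_yangMills_of_not_weakCouplingHypercubicLimitRP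
    (h : ¬ Summit.QuantumFields.YangMills.Theses.PencilRigidity.WeakCouplingHypercubicLimitRP) : ¬ YangMills :=
  fun hYM => h (weakCouplingHypercubicLimitRP_of_yangMills hYM)

/-- **Any kill of `MirrorModularBoosts.WeakCouplingHypercubicLimitRP` refutes `YangMills` as typed.** [folklore] -/
theorem not_yangMills_of_not_weakCouplingHypercubicLimitRP_mmb
    (h : ¬ Summit.QuantumFields.YangMills.Theses.MirrorModularBoosts.WeakCouplingHypercubicLimitRP) : ¬ YangMills :=
  fun hYM => h (weakCouplingHypercubicLimitRP_mmb_of_yangMills hYM)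

/-- The FOLD leg implies the old leg (drop the conjunct), PencilRigidity copy. [folklore] -/
theorem weakCouplingHypercubicLimit_of_weakCouplingHypercubicLimitRP
    (h : Summit.QuantumFields.YangMills.Theses.PencilRigidity.WeakCouplingHypercubicLimitRP) :
    Summit.QuantumFields.YangMills.Theses.PencilRigidity.WeakCouplingHypercubicLimit := fun G _ _ _ _ hG => by
  letI : MeasurableSpace G := borel G
  haveI : BorelSpace G := ⟨rfl⟩
  obtain ⟨r, sch, S, hweak, -, hzero, hW⟩ := h G hG
  exact ⟨r, sch, S, hweak, hzero, hW⟩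

/-- The FOLD leg implies the old leg, MirrorModularBoosts copy. [folklore] -/
theorem weakCouplingHypercubicLimit_of_weakCouplingHypercubicLimitRP_mmb
    (h : Summit.QuantumFields.YangMills.Theses.MirrorModularBoosts.WeakCouplingHypercubicLimitRP) :
    Summit.QuantumFields.YangMills.Theses.MirrorModularBoosts.WeakCouplingHypercubicLimit := fun G _ _ _ _ hG => by
  letI : MeasurableSpace G := borel G
  haveI : BorelSpace G := ⟨rfl⟩
  obtain ⟨r, sch, S, hweak, -, hW⟩ := h G hG
  exact ⟨r, sch, S, hweak, hW⟩

end Summit.QuantumFields.YangMills.Theorems.WeakCouplingHypercubicLimitRP.Negative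

end
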